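import Literature.AlgebraicTopology.SingularHomology.TransverseDiscFunctional
import HarnessLib

/-!
# The localisation functional of a zero set `P = K⁻¹(y₀)` and its values on classes crossing `P`
# at finitely many points

G. E. Bredon, *Topology and Geometry* (1993), VI.11 (Def. 11.1: the Thom class
`τ ∈ Hᵏ(W, W ∖ N)`; Thm. 11.9 and p. 375: the intersection number is the sum of the local
intersection numbers at the crossings); J. Milnor, *Lectures on the h-cobordism theorem* (1965),
proof of Lemma 6.3 (`H_r(M) → H_r(M, M - M ∩ M') ≅ Σᵢ H_r(Uᵢ, Uᵢ - pᵢ) → …`); A. Hatcher,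
*Algebraic Topology* (2002), Thm. 2.20, §3.3.  A HOMOLOGICAL Thom-class substitute for a closed
stratum `P ⊆ X` presented as a fibre: an open neighbourhood `N ⊇ P` and a continuous
`K : N → Y` with `K ≠ y₀` on `N ∖ P` (e.g. the zero set `{π = 0}` of a `ℂ`-valued function on an
open set of a manifold, `Y = ℂ`, `y₀ = 0`).  The functional is the composite

  `Λ : Hₖ(X) → Hₖ(X | P) ≅ Hₖ(N | P) → Hₖ(Y | y₀)`

(localisation, excision, push-forward along `K`); compare the transverse disc functional of
`…TransverseDiscFunctional` (there `Y` is a transverse disc met through a retraction, here the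
normal coordinate `K` itself is pushed forward, so no transverse disc and no manifold structure is
needed).  We prove:

* `isIso_map_subsetIncl_of_isClosed_subset` — the excision isomorphism `Hₖ(N | P) ≅ Hₖ(X | P)`
  (`P` closed inside the open `N`; Hatcher Thm. 2.20);
* **`map_eq_sum_smul_of_crossings`** — **the sum over the crossings**: let `φ : T → X` meet `P`
  exactly in finitely many points `vᵢ` with pairwise separating neighbourhoods `Uᵢ ∋ vᵢ`,
  `φ(Uᵢ) ⊆ N`; let `σ ∈ Hₖ(T)` have local pieces `wᵢ ∈ Hₖ(Uᵢ | vᵢ)` at the `vᵢ`, and suppose the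
  local values `(K ∘ φ|Uᵢ)⁎ wᵢ = dᵢ • b` in `Hₖ(Y | y₀)` are known.  Then for every class
  `z ∈ Hₖ(N | P)` excising the localisation of `φ⁎ σ` at `P`, `K⁎ z = (Σᵢ dᵢ) • b`
  (Milnor's diagram: naturality of localisation, additivity over the crossings
  `localHomologyOfSet.eq_sum_of_forall_map_eq_restrictLocal`, functoriality).

Everything is proved; no definitions, no named facts.  Consumer: the intersection indices of
spheres with a compact co-oriented surface `{π = 0}` in an almost complex 4-manifold
(`Literature/Geometry/Symplectic/SphereIntersectionIndexHomological…`), with the local values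
supplied by `…LocalDegreeWindingNumber`.

## References

* G. E. Bredon, *Topology and Geometry*, GTM 139, Springer (1993), VI.11 Def. 11.1, Thm. 11.9,
  p. 375. [Bredon1993]
* J. Milnor, *Lectures on the h-cobordism theorem*, Princeton (1965), proof of Lemma 6.3.
  [MilnorHCobordism1965]
* A. Hatcher, *Algebraic Topology*, CUP (2002), §2.1, Thm. 2.20, §3.3 p. 233. [HatcherAT2002]
-/

noncomputable section

open CategoryTheory Limits Set Function

universe u

namespace Literature.AlgebraicTopology.SingularHomology

variable {X : Type u} [TopologicalSpace X]

/-- **Excision for a closed set inside an open one**: for `P` closed, `N` open, `P ⊆ N`, the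
inclusion of pairs `(N, N ∖ P) → (X, X ∖ P)` induces isomorphisms `Hₖ(N | P) ≅ Hₖ(X | P)` (the
interiors of `X ∖ P` and `N` cover `X`; Hatcher 2002, Thm. 2.20). [cite: HatcherAT2002, Thm. 2.20] -/
theorem isIso_map_subsetIncl_of_isClosed_subset {P N : Set X} (hP : IsClosed P) (hN : IsOpen N)
    (hPN : P ⊆ N) (k : ℕ) :
    IsIso (relativeSingularHomology.map ℤ ℤ (subsetIncl N) (mapsTo_preimage Subtype.val Pᶜ) k) := by
  have hcov : interior Pᶜ ∪ interior N = univ := by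
    rw [hP.isOpen_compl.interior_eq, hN.interior_eq]
    exact eq_univ_of_forall fun x => (em (x ∈ P)).elim (fun h => Or.inr (hPN h)) Or.inl
  exact relativeSingularHomology.isIso_map_of_interior_union_interior_holds ℤ ℤ X Pᶜ N hcov k

/-- Isomorphisms of modules are injective on elements (bookkeeping). [folklore] -/
theorem injective_of_isIso {V W : ModuleCat.{u} ℤ} (f : V ⟶ W) [IsIso f] : Injective f :=
  (asIso f).toLinearEquiv.injective

/-- **A neighbourhood of one crossing is a map of pairs into `(N, N ∖ P)`**: if `φ` meets `P`
exactly in the points `v l` and `U i ∋ v i` contains no other `v l`, then `φ|Uᵢ` sends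
`Uᵢ ∖ vᵢ` into `N ∖ P`. [cite: MilnorHCobordism1965, proof of Lemma 6.3] -/
theorem mapsTo_crossingNhd {P N : Set X} {T : Type u} [TopologicalSpace T] (φ : C(T, X))
    {ι : Type*} [Fintype ι] {U : ι → Set T} (hUN : ∀ i, ∀ t ∈ U i, φ t ∈ N) {v : ι → T}
    (hvU : ∀ i, v i ∈ U i) (hsep : ∀ i l, l ≠ i → v l ∉ U i)
    (hF : {t | φ t ∈ P} = ⋃ i ∈ (Finset.univ : Finset ι), ({v i} : Set T)) (i : ι) :
    MapsTo (fun t : ↥(U i) => (⟨φ t, hUN i t t.2⟩ : ↥N)) ({(⟨v i, hvU i⟩ : ↥(U i))}ᶜ : Set ↥(U i))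
      (Subtype.val ⁻¹' Pᶜ) := by
  intro t ht htP
  have htF : (t : T) ∈ {t | φ t ∈ P} := htP
  rw [hF] at htF
  simp only [mem_iUnion, mem_singleton_iff, exists_prop] at htF
  obtain ⟨l, -, hl⟩ := htF
  by_cases hli : l = i
  · subst hli
    exact ht (Subtype.ext hl)
  · exact hsep i l hli (hl ▸ t.2)

/-- **The sum over the crossings** (Bredon 1993, VI.11 p. 375; Milnor 1965, proof of Lemma 6.3:
`H_r(M) → H_r(M, M - M ∩ M') ≅ Σᵢ H_r(Uᵢ, Uᵢ - pᵢ) → …`).  Let `P ⊆ N ⊆ X` with `P` closed and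
`N` open, `K : N → Y` continuous with `K ≠ y₀` off `P`.  Let `φ : T → X` (`T` a `T₁` space) meet
`P` exactly in the finitely many points `vᵢ`, with neighbourhoods `Uᵢ ∋ vᵢ` containing no other
`v_l` and `φ(Uᵢ) ⊆ N`.  Let `σ ∈ Hₖ(T)` have local pieces `wᵢ ∈ Hₖ(Uᵢ | vᵢ)` (classes whose
images in `Hₖ(T | vᵢ)` are the localisations of `σ`), whose local values are
`(K ∘ φ|Uᵢ)⁎ wᵢ = dᵢ • b`.  Then every `z ∈ Hₖ(N | P)` whose image in `Hₖ(X | P)` is the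
localisation of `φ⁎ σ` satisfies `K⁎ z = (Σᵢ dᵢ) • b` in `Hₖ(Y | y₀)`.
[cite: Bredon1993, VI.11 Thm. 11.9 and p. 375] [cite: MilnorHCobordism1965, proof of Lemma 6.3] [cite: HatcherAT2002, Thm. 2.20, §3.3 p. 233] -/
theorem map_eq_sum_smul_of_crossings {P N : Set X} (hP : IsClosed P) (hN : IsOpen N)
    (hPN : P ⊆ N) {Y : Type u} [TopologicalSpace Y] {y₀ : Y} (K : C(↥N, Y))
    (hK : MapsTo K (Subtype.val ⁻¹' Pᶜ) ({y₀}ᶜ : Set Y)) (k : ℕ)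
    {T : Type u} [TopologicalSpace T] [T1Space T] (φ : C(T, X))
    {ι : Type*} [Fintype ι] {U : ι → Set T} (hUN : ∀ i, ∀ t ∈ U i, φ t ∈ N)
    {v : ι → T} (hv : Injective v) (hvU : ∀ i, v i ∈ U i) (hsep : ∀ i l, l ≠ i → v l ∉ U i)
    (hF : {t | φ t ∈ P} = ⋃ i ∈ (Finset.univ : Finset ι), ({v i} : Set T))
    (σ : singularHomology ℤ ℤ T k)
    (w : ∀ i, relativeSingularHomology ℤ ℤ ↥(U i) {(⟨v i, hvU i⟩ : ↥(U i))}ᶜ k)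
    (hσ : ∀ i, relativeSingularHomology.map ℤ ℤ (subsetIncl (U i))
      (localHomology.mapsTo_subsetIncl_compl (hvU i)) k (w i) =
      singularHomology.toLocal ℤ ℤ (v i) k σ)
    (hKφ : ∀ i, MapsTo (fun t : ↥(U i) => K ⟨φ t, hUN i t t.2⟩) ({(⟨v i, hvU i⟩ : ↥(U i))}ᶜ : Set ↥(U i))
      ({y₀}ᶜ : Set Y))
    (b : localHomology ℤ ℤ Y y₀ k) (d : ι → ℤ)
    (hw : ∀ i, relativeSingularHomology.map ℤ ℤ
      (⟨fun t : ↥(U i) => K ⟨φ t, hUN i t t.2⟩, by fun_prop⟩ : C(↥(U i), Y)) (hKφ i) k (w i) = d i • b)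
    (z : relativeSingularHomology ℤ ℤ ↥N (Subtype.val ⁻¹' Pᶜ) k)
    (hz : relativeSingularHomology.map ℤ ℤ (subsetIncl N) (mapsTo_preimage Subtype.val Pᶜ) k z =
      singularHomology.toLocalOfSet ℤ ℤ X P k (singularHomology.map ℤ ℤ φ k σ)) :
    relativeSingularHomology.map ℤ ℤ K hK k z = (∑ i, d i) • b := by
  classical
  -- the crossing set `F = φ⁻¹(P)` and the localisation of `σ` at `F`
  set F : Set T := {t | φ t ∈ P} with hFdef
  have hφF : MapsTo φ Fᶜ Pᶜ := fun t ht h => ht h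
  set zT : localHomologyOfSet ℤ ℤ T F k := singularHomology.toLocalOfSet ℤ ℤ T F k σ with hzT
  -- Step 1: localisation is natural
  have h1 : singularHomology.toLocalOfSet ℤ ℤ X P k (singularHomology.map ℤ ℤ φ k σ) =
      relativeSingularHomology.map ℤ ℤ φ hφF k zT := by
    have e2 : singularHomology.map ℤ ℤ φ k ≫ singularHomology.toLocalOfSet ℤ ℤ X P k =
        singularHomology.toLocalOfSet ℤ ℤ T F k ≫ relativeSingularHomology.map ℤ ℤ φ hφF k := by
      rw [singularHomology.toLocalOfSet, singularHomology.toLocalOfSet,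
        relativeSingularHomology.ofAbsolute_comp_map]
    rw [← ModuleCat.comp_apply, e2, ModuleCat.comp_apply]
  -- Step 2: additivity of localisation over the crossings
  have hw' : ∀ i, relativeSingularHomology.map ℤ ℤ (subsetIncl (U i))
      (localHomology.mapsTo_subsetIncl_compl (hvU i)) k (w i) =
      restrictLocal ℤ ℤ (localHomologyOfSet.singleton_subset_of_eq_biUnion_singleton hF i) k zT := by
    intro i
    rw [hσ i, hzT, singularHomology.restrictLocal_toLocalOfSet]
    rfl
  have h2 := localHomologyOfSet.eq_sum_of_forall_map_eq_restrictLocal ℤ ℤ hv hvU hsep hF k zT _ hw'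
  -- Step 3: each term comes from `(U i, U i ∖ v i) → (N, N ∖ P)`
  have hφi : ∀ i, MapsTo (fun t : ↥(U i) => (⟨φ t, hUN i t t.2⟩ : ↥N))
      ({(⟨v i, hvU i⟩ : ↥(U i))}ᶜ : Set ↥(U i)) (Subtype.val ⁻¹' Pᶜ) :=
    mapsTo_crossingNhd φ hUN hvU hsep hF
  let φi : ∀ i, C(↥(U i), ↥N) := fun i => ⟨fun t => ⟨φ t, hUN i t t.2⟩, by fun_prop⟩
  have h3 : ∀ i, relativeSingularHomology.map ℤ ℤ φ hφF k
      (relativeSingularHomology.map ℤ ℤ (subsetIncl (U i))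
        (localHomologyOfSet.mapsTo_subsetIncl_compl_of_forall_notMem hF hvU hsep i) k (w i)) =
      relativeSingularHomology.map ℤ ℤ (subsetIncl N) (mapsTo_preimage Subtype.val Pᶜ) k
        (relativeSingularHomology.map ℤ ℤ (φi i) (hφi i) k (w i)) := by
    intro i
    rw [← ModuleCat.comp_apply, ← ModuleCat.comp_apply, ← relativeSingularHomology.map_comp,
      ← relativeSingularHomology.map_comp]
    rfl
  -- hence `z = Σᵢ (φ_i)⁎ wᵢ` by injectivity of excision
  haveI := isIso_map_subsetIncl_of_isClosed_subset hP hN hPN k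
  have hzsum : z = ∑ i, relativeSingularHomology.map ℤ ℤ (φi i) (hφi i) k (w i) := by
    apply injective_of_isIso (relativeSingularHomology.map ℤ ℤ (subsetIncl N) (mapsTo_preimage Subtype.val Pᶜ) k)
    rw [hz, h1, h2, map_sum, map_sum]
    exact Finset.sum_congr rfl fun i _ => h3 i
  -- Step 4: push along `K`
  have h4 : ∀ i, relativeSingularHomology.map ℤ ℤ K hK k
      (relativeSingularHomology.map ℤ ℤ (φi i) (hφi i) k (w i)) = d i • b := by
    intro i
    rw [← hw i, ← ModuleCat.comp_apply, ← relativeSingularHomology.map_comp]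
    rfl
  rw [hzsum, map_sum, Finset.sum_congr rfl fun i _ => h4 i]
  exact (sum_zsmul_eq _ _ _).symm

end Literature.AlgebraicTopology.SingularHomology

end
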